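import Summits.CriticalPhenomena.PercolationContinuityZ3.Theorems.Transplant.FKDoubleFanCrossApexInKE
import Summits.CriticalPhenomena.PercolationContinuityZ3.Theorems.Transplant.FKDoubleFanNegCorrAdjacent
import HarnessLib

/-!
# Double fans `K₂ ∨ P_{m+1}`: NEGATIVE CORRELATION OF THE CROSS-APEX ADJACENT SPOKES `a c_j`, `b c_{j+1}`

Helper file (`--supports stmt-CriticalPhenomena-4575`), FK sub-lane `prim-bschramm-fk-3` (gen 25); builds on p205010 (kernel theorem, internal
audit signed; external expert review pending).  No named facts, no sorries; standard axioms.  Memo `bschramm/prim-bschramm-fk-3/U-RIM.md` §4.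

The last step of the cross-apex programme (`…CrossApexLeaves/Core/Roof/InKE`).  The cut formula of `…DoubleFanNegCorr` at block `j+1`
writes the four partition functions of the weighted double fan with the spokes `a c_j ↦ σ`, `b c_{j+1} ↦ τ` pinned as the `crossZ`
valuations `val(s ∗ edgeBC(τ) ∗ E_r(edgeAC(σ) ∗ u))` with `u = edgeBC(w_{b c_j}) ∗ (input of block j)` and
`s = (reversed suffix after block j+1) ∗ edgeAC(w_{a c_{j+1}})`, both in `InKE q` (`cut_pin_spokes_cross`); `InKE.rayleigh_cross_nonneg`
then gives **`negCorr_spokes_cross`**: for `0 < q ≤ 1`, every weight vector on the double fan and every `j < m`,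
`φ(J_{a c_j} ∩ J_{b c_{j+1}}) ≤ φ(J_{a c_j})·φ(J_{b c_{j+1}})`, and `negCorr_spokes_cross'` for the mirror pair `(b c_j, a c_{j+1})` (`a ↔ b`).  With
`negCorr_spokes` (same rim vertex), `negCorr_spokesA_adjacent`, `negCorr_axis_spoke*`, `negCorr_axis_rim`, `negCorr_rim_spoke*` this
completes negative correlation for ALL pairs of ADJACENT edges of a weighted double fan at `0 < q ≤ 1`.
[cite: Grimmett2006, §3.9 eq. (3.94) (pp. 63–64); §1.4 eq. (1.20) (p. 15)] [folklore]
-/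

noncomputable section

namespace Summit.CriticalPhenomena.PercolationContinuityZ3.Theorems

namespace FK

namespace ThreeApex

open MeasureTheory Literature.Probability.LatticeModels Literature.Probability.Percolation
open scoped Classical

variable {V : Type*} [Fintype V]

section Setting

variable {a b : V} {c : ℕ → V} {m : ℕ}
variable (hab : a ≠ b) (hinj : ∀ j k, j ≤ m → k ≤ m → c j = c k → j = k) (hca : ∀ j, j ≤ m → c j ≠ a) (hcb : ∀ j, j ≤ m → c j ≠ b)
include hab hinj hca hcb

omit [Fintype V] in
/-- **The word with the spokes `a c_j` and `b c_{j+1}` pinned**, through the cut at block `j+1`: the four partition functions are the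
`crossZ` valuations with `u = edgeBC(w_{b c_j}) ∗ (input of block j)` and `s = (reversed suffix) ∗ edgeAC(w_{a c_{j+1}})`. [folklore] -/
theorem cut_pin_spokes_cross (q : ℝ) (w : Sym2 V → unitInterval) {j : ℕ} (hj : j + 1 ≤ m) (σ τ : unitInterval) :
    transferDF q (Function.update (Function.update w s(a, c j) σ) s(b, c (j + 1)) τ) a b c m =
      crossZ q (wR w s(c j, c (j + 1))) (conv (edgeBC (wR w s(b, c j))) (blockIn q w a b c j))
        (conv (restVec q w a b c (j + 1) (m - (j + 1))) (edgeAC (wR w s(a, c (j + 1))))) (σ : ℝ) (τ : ℝ) := by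
  set w₁ := Function.update w s(a, c j) σ with hw₁
  set w₂ := Function.update w₁ s(b, c (j + 1)) τ with hw₂
  have hj0 : j ≤ m := by omega
  have hlater1 : ∀ k, j + 1 < k → k ≤ m → ¬ ReadsAt a b c k s(a, c j) := fun k hk hkm hr =>
    absurd ((readsAt_spokeA_iff hab hinj hca hcb hj0 hkm).1 hr) (by omega)
  have hlater2 : ∀ k, j + 1 < k → k ≤ m → ¬ ReadsAt a b c k s(b, c (j + 1)) := fun k hk hkm hr =>
    absurd ((readsAt_spokeB_iff hab hinj hca hcb hj hkm).1 hr) (by omega)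
  have hrest : restVec q w₂ a b c (j + 1) (m - (j + 1)) = restVec q w a b c (j + 1) (m - (j + 1)) := by
    rw [hw₂, restVec_update_eq q w₁ τ (m - (j + 1)) (j + 1) (by omega) hlater2, hw₁,
      restVec_update_eq q w σ (m - (j + 1)) (j + 1) (by omega) hlater1]
  have hin : blockIn q w₂ a b c j = blockIn q w a b c j := by
    rw [hw₂, blockIn_update_eq q w₁ τ (fun k hk hr => absurd ((readsAt_spokeB_iff hab hinj hca hcb hj (by omega)).1 hr) (by omega))
      (spokeB_ne_axis hab hca hj) (fun i hi => spokeB_ne_rim hcb (j := j + 1) (by omega)),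
      hw₁, blockIn_update_eq q w σ (fun k hk hr => absurd ((readsAt_spokeA_iff hab hinj hca hcb hj0 (by omega)).1 hr) (by omega))
      (spokeA_ne_axis hab hcb hj0) (fun i hi => hi ▸ spokeA_ne_rim hca (j := i + 1) (hi ▸ hj0))]
  have hσ : wR w₂ s(a, c j) = (σ : ℝ) := by
    rw [hw₂, wR_update_of_ne w₁ (spokeA_ne_spokeB hab hca (j := j) hj), hw₁, wR_update_self]
  have hτ : wR w₂ s(b, c (j + 1)) = (τ : ℝ) := by rw [hw₂, wR_update_self]
  have hy0 : wR w₂ s(b, c j) = wR w s(b, c j) := by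
    rw [hw₂, wR_update_of_ne w₁ (spokeB_ne_spokeB hinj hj0 hj (by omega)), hw₁,
      wR_update_of_ne w (spokeA_ne_spokeB hab hca hj0).symm]
  have hx1 : wR w₂ s(a, c (j + 1)) = wR w s(a, c (j + 1)) := by
    rw [hw₂, wR_update_of_ne w₁ (spokeA_ne_spokeB hab hca (j := j + 1) hj), hw₁,
      wR_update_of_ne w (spokeA_ne_spokeA hinj hj hj0 (by omega))]
  have hr : wR w₂ s(c j, c (j + 1)) = wR w s(c j, c (j + 1)) := by
    rw [hw₂, wR_update_of_ne w₁ (spokeB_ne_rim hcb (j := j + 1) hj).symm, hw₁,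
      wR_update_of_ne w (spokeA_ne_rim hca (j := j) hj).symm]
  rw [transferDF_eq_cut q w₂ a b c hj, zDF_eq_block, hrest, blockIn_succ, zDF_eq_block q w₂ a b c j, hin, hσ, hτ, hy0, hx1, hr]
  -- reassociate: s' ∗ (AC x ∗ (BC τ ∗ R)) = (s' ∗ AC x) ∗ (BC τ ∗ R)
  simp only [crossZ, ← mul_def]
  simp only [mul_assoc]

/-- **NEGATIVE CORRELATION OF THE CROSS-APEX ADJACENT SPOKES** of a weighted double fan `K₂ ∨ P_{m+1}` (`0 < q ≤ 1`,
`card V = m + 3`, `w` supported on the double fan, `j + 1 ≤ m`): `φ(J_{a c_j} ∩ J_{b c_{j+1}}) ≤ φ(J_{a c_j})·φ(J_{b c_{j+1}})`.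
[cite: Grimmett2006, §3.9 eq. (3.94) (pp. 63–64)] -/
theorem negCorr_spokes_cross (hcard : Fintype.card V = m + 3) {q : ℝ} (hq0 : 0 < q) (hq1 : q ≤ 1) (w : Sym2 V → unitInterval)
    (hsupp : ∀ e, e ∉ dfPairs a b c m → w e = 0) {j : ℕ} (hj : j + 1 ≤ m) :
    (rcMeasureW w q ∅).real ({ω : BondConfig V | s(a, c j) ∈ ω} ∩ {ω | s(b, c (j + 1)) ∈ ω}) ≤
      (rcMeasureW w q ∅).real {ω : BondConfig V | s(a, c j) ∈ ω} *
        (rcMeasureW w q ∅).real {ω : BondConfig V | s(b, c (j + 1)) ∈ ω} := by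
  have hj0 : j ≤ m := by omega
  have he : s(a, c j) ∈ dfPairs a b c m := (mem_dfPairs_iff a b c m _).2 (Or.inr (Or.inl ⟨j, hj0, Or.inl rfl⟩))
  have hf : s(b, c (j + 1)) ∈ dfPairs a b c m := (mem_dfPairs_iff a b c m _).2 (Or.inr (Or.inl ⟨j + 1, hj, Or.inr rfl⟩))
  have hne : s(b, c (j + 1)) ≠ s(a, c j) := (spokeA_ne_spokeB hab hca (j := j) hj).symm
  set u := conv (edgeBC (wR w s(b, c j))) (blockIn q w a b c j) with hu
  set s := conv (restVec q w a b c (j + 1) (m - (j + 1))) (edgeAC (wR w s(a, c (j + 1)))) with hs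
  have hZ : ∀ σ τ : unitInterval, rcPartitionFunctionW (Function.update (Function.update w s(a, c j) σ) s(b, c (j + 1)) τ) q ∅ =
      crossZ q (wR w s(c j, c (j + 1))) u s (σ : ℝ) (τ : ℝ) := by
    intro σ τ
    rw [rcPartitionFunctionW_eq_transferDF hab hinj hca hcb hcard q _
      (supp_update_dfPair _ (supp_update_dfPair w hsupp he σ) hf τ),
      cut_pin_spokes_cross hab hinj hca hcb q w hj σ τ]
  have huK : InKE q u := InKE.step (IsLetter.bc (w _).2.1 (w _).2.2) (inKE_blockIn q w a b c j)
  have hsK : InKE q s := InKE.mul (inKE_restVec q w a b c (m - (j + 1)) (j + 1)) (by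
    rw [← mul_one (edgeAC (wR w s(a, c (j + 1)))), mul_def, one_def]
    exact InKE.step (IsLetter.ac (w _).2.1 (w _).2.2) InKE.base)
  have key := InKE.rayleigh_cross_nonneg (r := wR w s(c j, c (j + 1))) hq0 hq1 (w s(c j, c (j + 1))).2.1
    (w s(c j, c (j + 1))).2.2 huK hsK
  refine negCorr_of_pinned_rayleigh w hq0 hne ?_
  rw [hZ 1 1, hZ 0 0, hZ 1 0, hZ 0 1]
  simp only [Set.Icc.coe_one, Set.Icc.coe_zero]
  linarith [key]

/-- **The mirror pair `(b c_j, a c_{j+1})`** (the `a ↔ b` relabelling of `negCorr_spokes_cross`). [cite: Grimmett2006, §3.9 eq. (3.94) (pp. 63–64)] -/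
theorem negCorr_spokes_cross' (hcard : Fintype.card V = m + 3) {q : ℝ} (hq0 : 0 < q) (hq1 : q ≤ 1) (w : Sym2 V → unitInterval)
    (hsupp : ∀ e, e ∉ dfPairs a b c m → w e = 0) {j : ℕ} (hj : j + 1 ≤ m) :
    (rcMeasureW w q ∅).real ({ω : BondConfig V | s(b, c j) ∈ ω} ∩ {ω | s(a, c (j + 1)) ∈ ω}) ≤
      (rcMeasureW w q ∅).real {ω : BondConfig V | s(b, c j) ∈ ω} *
        (rcMeasureW w q ∅).real {ω : BondConfig V | s(a, c (j + 1)) ∈ ω} :=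
  negCorr_spokes_cross hab.symm hinj hcb hca hcard hq0 hq1 w (fun e he => hsupp e (by rwa [dfPairs_swap] at he)) hj

end Setting

end ThreeApex

end FK

end Summit.CriticalPhenomena.PercolationContinuityZ3.Theorems
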